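import Literature.Analysis.PDE.ParabolicHolderCompactness
import HarnessLib

/-!
# Parabolic chain rule: jets of `g (ξ, t) = f (θ (ξ, t), t)` and their Hölder bounds

Topic `Literature/Analysis/PDE`.  For a change of the SPACE variable depending on time,
`Θ (ξ, t) = (θ (ξ, t), t)`, and a function `f` of spacetime, the composition `g = f ∘ Θ` has the
jets (under the regularity guard `IsC21On` on open sets)

* `D g = (D f ∘ Θ) ∘ D θ`                                  (`spaceDeriv_scomp`),
* `∂ₜ g = (D f ∘ Θ) (∂ₜ θ) + ∂ₜ f ∘ Θ`                      (`timeDeriv_scomp`),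
* `D² g v w = (D² f ∘ Θ) (Dθ v) (Dθ w) + (D f ∘ Θ) (D²θ v w)` (`spaceDeriv_spaceDeriv_scomp`),

and satisfies the guard (`IsC21On.scomp`).  From sup bounds and parabolic Hölder moduli of the
jets of `f` and `θ`, and the parabolic Lipschitz constant of `Θ`, one reads off sup bounds and
Hölder moduli of the jets of `g` (`norm_*_scomp_*`).  This is the calculus behind re-graphing a
parabolic `C^{2,α}` graph over a tilted frame (White 2005, p. 1499).

Everything is PROVED; no definitions, no named facts.

## References

* B. White, *A local regularity theorem for mean curvature flow*, Ann. of Math. 161 (2005), §2.5,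
  §8. [White2005]
-/

noncomputable section

open Metric Set Filter
open scoped NNReal Topology

namespace Literature.Analysis.PDE

namespace Parabolic

variable {E₁ E₂ F : Type*} [NormedAddCommGroup E₁] [NormedSpace ℝ E₁] [NormedAddCommGroup E₂]
  [NormedSpace ℝ E₂] [NormedAddCommGroup F] [NormedSpace ℝ F]

/-! ### Joint derivative versus `D` and `∂ₜ` -/

/-- The joint derivative applied to `(v, 0)` is `D u X v`. [folklore] -/
theorem fderiv_apply_inl_eq_spaceDeriv {u : Parabolic E₂ → F} {x : E₂} {t : ℝ}
    (h : DifferentiableAt ℝ (fun p : E₂ × ℝ => u ⟨p.1, p.2⟩) (x, t)) (v : E₂) :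
    fderiv ℝ (fun p : E₂ × ℝ => u ⟨p.1, p.2⟩) (x, t) (v, 0) = spaceDeriv u ⟨x, t⟩ v := by
  have hin : HasFDerivAt (fun x' : E₂ => (x', t)) (ContinuousLinearMap.inl ℝ E₂ ℝ) x :=
    (hasFDerivAt_id x).prodMk (hasFDerivAt_const t x)
  have hcomp := h.hasFDerivAt.comp x hin
  have h1 : spaceDeriv u ⟨x, t⟩ =
      (fderiv ℝ (fun p : E₂ × ℝ => u ⟨p.1, p.2⟩) (x, t)).comp (ContinuousLinearMap.inl ℝ E₂ ℝ) :=
    hcomp.fderiv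
  rw [h1]
  rfl

/-- The joint derivative applied to `(0, 1)` is `∂ₜ u X`. [folklore] -/
theorem fderiv_apply_inr_eq_timeDeriv {u : Parabolic E₂ → F} {x : E₂} {t : ℝ}
    (h : DifferentiableAt ℝ (fun p : E₂ × ℝ => u ⟨p.1, p.2⟩) (x, t)) :
    fderiv ℝ (fun p : E₂ × ℝ => u ⟨p.1, p.2⟩) (x, t) (0, 1) = timeDeriv u ⟨x, t⟩ := by
  have hin : HasDerivAt (fun t' : ℝ => ((x, t') : E₂ × ℝ)) ((0 : E₂), (1 : ℝ)) t :=
    (hasDerivAt_const t x).prodMk (hasDerivAt_id t)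
  have hcomp := h.hasFDerivAt.comp_hasDerivAt_of_eq t hin rfl
  have h1 : timeDeriv u ⟨x, t⟩ = fderiv ℝ (fun p : E₂ × ℝ => u ⟨p.1, p.2⟩) (x, t) (0, 1) :=
    hcomp.deriv
  exact h1.symm

/-! ### Jets of the composition -/

section Jets

variable {θ : Parabolic E₁ → E₂} {f : Parabolic E₂ → F} {W₁ : Set (Parabolic E₁)}
  {W₂ : Set (Parabolic E₂)} (hθ : IsC21On θ W₁) (hf : IsC21On f W₂)
  (hmaps : ∀ Ξ ∈ W₁, (⟨θ Ξ, Ξ.t⟩ : Parabolic E₂) ∈ W₂)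

include hθ hf hmaps in
/-- Spatial slices of `g = f ∘ Θ`: derivative `(D f ∘ Θ) ∘ D θ`. [folklore] -/
theorem hasFDerivAt_space_scomp {ξ : E₁} {t : ℝ} (hΞ : (⟨ξ, t⟩ : Parabolic E₁) ∈ W₁) :
    HasFDerivAt (fun ξ' => f ⟨θ ⟨ξ', t⟩, t⟩)
      ((spaceDeriv f ⟨θ ⟨ξ, t⟩, t⟩).comp (spaceDeriv θ ⟨ξ, t⟩)) ξ := by
  have h1 : HasFDerivAt (fun x' => f ⟨x', t⟩) (spaceDeriv f ⟨θ ⟨ξ, t⟩, t⟩) (θ ⟨ξ, t⟩) :=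
    hf.hasFDerivAt_space (hmaps _ hΞ)
  exact h1.comp ξ (hθ.hasFDerivAt_space hΞ)

include hθ hf hmaps in
/-- `D (f ∘ Θ) = (D f ∘ Θ) ∘ D θ`. [folklore] -/
theorem spaceDeriv_scomp {Ξ : Parabolic E₁} (hΞ : Ξ ∈ W₁) :
    spaceDeriv (fun Ξ' : Parabolic E₁ => f ⟨θ Ξ', Ξ'.t⟩) Ξ =
      (spaceDeriv f ⟨θ Ξ, Ξ.t⟩).comp (spaceDeriv θ Ξ) := by
  cases Ξ with
  | mk ξ t => exact (hasFDerivAt_space_scomp hθ hf hmaps hΞ).fderiv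

include hθ hf hmaps in
/-- Time slices of `g = f ∘ Θ`: derivative `(D f ∘ Θ) (∂ₜ θ) + ∂ₜ f ∘ Θ`. [folklore] -/
theorem hasDerivAt_time_scomp {ξ : E₁} {t : ℝ} (hΞ : (⟨ξ, t⟩ : Parabolic E₁) ∈ W₁) :
    HasDerivAt (fun t' => f ⟨θ ⟨ξ, t'⟩, t'⟩)
      (spaceDeriv f ⟨θ ⟨ξ, t⟩, t⟩ (timeDeriv θ ⟨ξ, t⟩) + timeDeriv f ⟨θ ⟨ξ, t⟩, t⟩) t := by
  have hcurve : HasDerivAt (fun t' : ℝ => ((θ ⟨ξ, t'⟩, t') : E₂ × ℝ))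
      (timeDeriv θ ⟨ξ, t⟩, (1 : ℝ)) t :=
    (hθ.hasDerivAt_time hΞ).prodMk (hasDerivAt_id t)
  have hfd : DifferentiableAt ℝ (fun p : E₂ × ℝ => f ⟨p.1, p.2⟩) (θ ⟨ξ, t⟩, t) :=
    hf.differentiableAt ⟨θ ⟨ξ, t⟩, t⟩ (hmaps _ hΞ)
  have h := hfd.hasFDerivAt.comp_hasDerivAt_of_eq t hcurve rfl
  have heq : fderiv ℝ (fun p : E₂ × ℝ => f ⟨p.1, p.2⟩) (θ ⟨ξ, t⟩, t) (timeDeriv θ ⟨ξ, t⟩, 1) =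
      spaceDeriv f ⟨θ ⟨ξ, t⟩, t⟩ (timeDeriv θ ⟨ξ, t⟩) + timeDeriv f ⟨θ ⟨ξ, t⟩, t⟩ := by
    have hsplit : ((timeDeriv θ ⟨ξ, t⟩, (1 : ℝ)) : E₂ × ℝ) = (timeDeriv θ ⟨ξ, t⟩, 0) + (0, 1) := by
      simp
    rw [hsplit, map_add, fderiv_apply_inl_eq_spaceDeriv hfd, fderiv_apply_inr_eq_timeDeriv hfd]
  rw [heq] at h
  exact h

include hθ hf hmaps in
/-- `∂ₜ (f ∘ Θ) = (D f ∘ Θ) (∂ₜ θ) + ∂ₜ f ∘ Θ`. [folklore] -/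
theorem timeDeriv_scomp {Ξ : Parabolic E₁} (hΞ : Ξ ∈ W₁) :
    timeDeriv (fun Ξ' : Parabolic E₁ => f ⟨θ Ξ', Ξ'.t⟩) Ξ =
      spaceDeriv f ⟨θ Ξ, Ξ.t⟩ (timeDeriv θ Ξ) + timeDeriv f ⟨θ Ξ, Ξ.t⟩ := by
  cases Ξ with
  | mk ξ t => exact (hasDerivAt_time_scomp hθ hf hmaps hΞ).deriv

include hθ hf hmaps in
/-- Spatial slices of `D (f ∘ Θ)` on an open `W₁`: derivative
`v ↦ (D² f ∘ Θ) (Dθ v) ∘ Dθ + (D f ∘ Θ) ∘ (D²θ v)`. [folklore] -/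
theorem hasFDerivAt_spaceDeriv_scomp (hW₁ : IsOpen W₁) {ξ : E₁} {t : ℝ}
    (hΞ : (⟨ξ, t⟩ : Parabolic E₁) ∈ W₁) :
    HasFDerivAt (fun ξ' => spaceDeriv (fun Ξ' : Parabolic E₁ => f ⟨θ Ξ', Ξ'.t⟩) ⟨ξ', t⟩)
      (((ContinuousLinearMap.compL ℝ E₁ E₂ F) (spaceDeriv f ⟨θ ⟨ξ, t⟩, t⟩)).comp
          (spaceDeriv (spaceDeriv θ) ⟨ξ, t⟩) +
        (((ContinuousLinearMap.compL ℝ E₁ E₂ F).flip (spaceDeriv θ ⟨ξ, t⟩)).comp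
          ((spaceDeriv (spaceDeriv f) ⟨θ ⟨ξ, t⟩, t⟩).comp (spaceDeriv θ ⟨ξ, t⟩)))) ξ := by
  -- near `ξ` the function is `ξ' ↦ (Df (θ(ξ',t), t)) ∘ (Dθ (ξ', t))`
  have hslice : IsOpen {ξ' : E₁ | (⟨ξ', t⟩ : Parabolic E₁) ∈ W₁} :=
    hW₁.preimage (homeomorphProd.symm.continuous.comp (continuous_id.prodMk continuous_const))
  have hev : (fun ξ' => spaceDeriv (fun Ξ' : Parabolic E₁ => f ⟨θ Ξ', Ξ'.t⟩) ⟨ξ', t⟩) =ᶠ[𝓝 ξ]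
      fun ξ' => (spaceDeriv f ⟨θ ⟨ξ', t⟩, t⟩).comp (spaceDeriv θ ⟨ξ', t⟩) := by
    filter_upwards [hslice.mem_nhds (show ξ ∈ {ξ' : E₁ | (⟨ξ', t⟩ : Parabolic E₁) ∈ W₁} from hΞ)]
      with ξ' hξ'
    exact spaceDeriv_scomp hθ hf hmaps hξ'
  refine HasFDerivAt.congr_of_eventuallyEq ?_ hev
  have h0 : HasFDerivAt (fun x' => spaceDeriv f ⟨x', t⟩)
      (spaceDeriv (spaceDeriv f) ⟨θ ⟨ξ, t⟩, t⟩) (θ ⟨ξ, t⟩) :=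
    hf.hasFDerivAt_spaceDeriv (hmaps _ hΞ)
  have h1 := h0.comp ξ (hθ.hasFDerivAt_space hΞ)
  have h2 : HasFDerivAt (fun ξ' => spaceDeriv θ ⟨ξ', t⟩) (spaceDeriv (spaceDeriv θ) ⟨ξ, t⟩) ξ :=
    hθ.hasFDerivAt_spaceDeriv hΞ
  exact h1.clm_comp h2

include hθ hf hmaps in
/-- `D² (f ∘ Θ) v w = (D² f ∘ Θ) (Dθ v) (Dθ w) + (D f ∘ Θ) (D²θ v w)` on an open `W₁`.
[folklore] -/
theorem spaceDeriv_spaceDeriv_scomp (hW₁ : IsOpen W₁) {Ξ : Parabolic E₁} (hΞ : Ξ ∈ W₁)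
    (v w : E₁) :
    spaceDeriv (spaceDeriv fun Ξ' : Parabolic E₁ => f ⟨θ Ξ', Ξ'.t⟩) Ξ v w =
      spaceDeriv (spaceDeriv f) ⟨θ Ξ, Ξ.t⟩ (spaceDeriv θ Ξ v) (spaceDeriv θ Ξ w) +
        spaceDeriv f ⟨θ Ξ, Ξ.t⟩ (spaceDeriv (spaceDeriv θ) Ξ v w) := by
  cases Ξ with
  | mk ξ t =>
    rw [show spaceDeriv (spaceDeriv fun Ξ' : Parabolic E₁ => f ⟨θ Ξ', Ξ'.t⟩) ⟨ξ, t⟩ = _ from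
      (hasFDerivAt_spaceDeriv_scomp hθ hf hmaps hW₁ hΞ).fderiv]
    simp only [add_apply, ContinuousLinearMap.comp_apply,
      ContinuousLinearMap.compL_apply, ContinuousLinearMap.flip_apply]
    exact add_comm _ _

include hθ hf hmaps in
/-- The composition `f ∘ Θ` satisfies the regularity guard on an open `W₁`. [folklore] -/
theorem IsC21On.scomp (hW₁ : IsOpen W₁) :
    IsC21On (fun Ξ' : Parabolic E₁ => f ⟨θ Ξ', Ξ'.t⟩) W₁ := by
  refine ⟨fun Ξ hΞ => ?_, fun Ξ hΞ => ?_⟩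
  · have hin : DifferentiableAt ℝ (fun p : E₁ × ℝ => ((θ ⟨p.1, p.2⟩, p.2) : E₂ × ℝ)) (Ξ.x, Ξ.t) :=
      (hθ.differentiableAt Ξ hΞ).prodMk differentiableAt_snd
    have hout : DifferentiableAt ℝ (fun q : E₂ × ℝ => f ⟨q.1, q.2⟩) (θ ⟨Ξ.x, Ξ.t⟩, Ξ.t) :=
      hf.differentiableAt ⟨θ Ξ, Ξ.t⟩ (hmaps Ξ hΞ)
    have h := hout.comp (Ξ.x, Ξ.t) hin
    exact h
  · cases Ξ with
    | mk ξ t => exact (hasFDerivAt_spaceDeriv_scomp hθ hf hmaps hW₁ hΞ).differentiableAt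

end Jets

/-! ### Elementary difference estimates for bilinear expressions -/

section Bilinear

variable {G₁ G₂ G₃ : Type*} [NormedAddCommGroup G₁] [NormedSpace ℝ G₁] [NormedAddCommGroup G₂]
  [NormedSpace ℝ G₂] [NormedAddCommGroup G₃] [NormedSpace ℝ G₃]

/-- `‖S ∘ R - S' ∘ R'‖ ≤ ‖S - S'‖ ‖R‖ + ‖S'‖ ‖R - R'‖`. [folklore] -/
theorem norm_comp_sub_comp_le (S S' : G₂ →L[ℝ] G₃) (R R' : G₁ →L[ℝ] G₂) :
    ‖S.comp R - S'.comp R'‖ ≤ ‖S - S'‖ * ‖R‖ + ‖S'‖ * ‖R - R'‖ := by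
  have h : S.comp R - S'.comp R' = (S - S').comp R + S'.comp (R - R') := by
    ext v; simp
  rw [h]
  exact (norm_add_le _ _).trans (add_le_add (ContinuousLinearMap.opNorm_comp_le _ _)
    (ContinuousLinearMap.opNorm_comp_le _ _))

/-- `‖S v - S' v'‖ ≤ ‖S - S'‖ ‖v‖ + ‖S'‖ ‖v - v'‖`. [folklore] -/
theorem norm_apply_sub_apply_le (S S' : G₁ →L[ℝ] G₂) (v v' : G₁) :
    ‖S v - S' v'‖ ≤ ‖S - S'‖ * ‖v‖ + ‖S'‖ * ‖v - v'‖ := by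
  have h : S v - S' v' = (S - S') v + S' (v - v') := by simp
  rw [h]
  exact (norm_add_le _ _).trans (add_le_add (ContinuousLinearMap.le_opNorm _ _)
    (ContinuousLinearMap.le_opNorm _ _))

/-- `‖M (R v) (R w) - M' (R' v) (R' w)‖ ≤ (‖M - M'‖ ‖R‖² + ‖M'‖ ‖R - R'‖ (‖R‖ + ‖R'‖)) ‖v‖ ‖w‖` for
bilinear `M, M'`. [folklore] -/
theorem norm_bilin_comp_sub_le (M M' : G₂ →L[ℝ] G₂ →L[ℝ] G₃) (R R' : G₁ →L[ℝ] G₂) (v w : G₁) :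
    ‖M (R v) (R w) - M' (R' v) (R' w)‖ ≤
      (‖M - M'‖ * ‖R‖ ^ 2 + ‖M'‖ * ‖R - R'‖ * (‖R‖ + ‖R'‖)) * ‖v‖ * ‖w‖ := by
  have h : M (R v) (R w) - M' (R' v) (R' w) =
      (M - M') (R v) (R w) + M' ((R - R') v) (R w) + M' (R' v) ((R - R') w) := by
    simp only [sub_apply, map_sub]
    abel
  rw [h]
  have h1 : ‖(M - M') (R v) (R w)‖ ≤ ‖M - M'‖ * ‖R‖ ^ 2 * ‖v‖ * ‖w‖ := by
    calc ‖(M - M') (R v) (R w)‖ ≤ ‖M - M'‖ * ‖R v‖ * ‖R w‖ := (M - M').le_opNorm₂ _ _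
      _ ≤ ‖M - M'‖ * (‖R‖ * ‖v‖) * (‖R‖ * ‖w‖) := by
          gcongr <;> exact R.le_opNorm _
      _ = ‖M - M'‖ * ‖R‖ ^ 2 * ‖v‖ * ‖w‖ := by ring
  have h2 : ‖M' ((R - R') v) (R w)‖ ≤ ‖M'‖ * ‖R - R'‖ * ‖R‖ * ‖v‖ * ‖w‖ := by
    calc ‖M' ((R - R') v) (R w)‖ ≤ ‖M'‖ * ‖(R - R') v‖ * ‖R w‖ := M'.le_opNorm₂ _ _
      _ ≤ ‖M'‖ * (‖R - R'‖ * ‖v‖) * (‖R‖ * ‖w‖) := by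
          gcongr
          · exact (R - R').le_opNorm _
          · exact R.le_opNorm _
      _ = ‖M'‖ * ‖R - R'‖ * ‖R‖ * ‖v‖ * ‖w‖ := by ring
  have h3 : ‖M' (R' v) ((R - R') w)‖ ≤ ‖M'‖ * ‖R - R'‖ * ‖R'‖ * ‖v‖ * ‖w‖ := by
    calc ‖M' (R' v) ((R - R') w)‖ ≤ ‖M'‖ * ‖R' v‖ * ‖(R - R') w‖ := M'.le_opNorm₂ _ _
      _ ≤ ‖M'‖ * (‖R'‖ * ‖v‖) * (‖R - R'‖ * ‖w‖) := by
          gcongr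
          · exact R'.le_opNorm _
          · exact (R - R').le_opNorm _
      _ = ‖M'‖ * ‖R - R'‖ * ‖R'‖ * ‖v‖ * ‖w‖ := by ring
  calc ‖(M - M') (R v) (R w) + M' ((R - R') v) (R w) + M' (R' v) ((R - R') w)‖
      ≤ ‖(M - M') (R v) (R w)‖ + ‖M' ((R - R') v) (R w)‖ + ‖M' (R' v) ((R - R') w)‖ :=
        norm_add₃_le
    _ ≤ ‖M - M'‖ * ‖R‖ ^ 2 * ‖v‖ * ‖w‖ + ‖M'‖ * ‖R - R'‖ * ‖R‖ * ‖v‖ * ‖w‖ +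
        ‖M'‖ * ‖R - R'‖ * ‖R'‖ * ‖v‖ * ‖w‖ := add_le_add (add_le_add h1 h2) h3
    _ = _ := by ring

end Bilinear

/-! ### Bounds for the jets of the composition -/

section Bounds

variable {θ : Parabolic E₁ → E₂} {f : Parabolic E₂ → F} {W₁ : Set (Parabolic E₁)}
  {W₂ : Set (Parabolic E₂)} (hθ : IsC21On θ W₁) (hf : IsC21On f W₂)
  (hmaps : ∀ Ξ ∈ W₁, (⟨θ Ξ, Ξ.t⟩ : Parabolic E₂) ∈ W₂) (hW₁ : IsOpen W₁)

omit [NormedSpace ℝ E₁] [NormedSpace ℝ E₂] in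
/-- For `0 ≤ d`, `0 ≤ Λ`: `(Λ d)^α = Λ^α d^α`; packaged as the bound used below. [folklore] -/
theorem rpow_dist_scomp_le {α : ℝ≥0} {Λ : ℝ} (hΛ : 0 ≤ Λ) {Ξ Ξ' : Parabolic E₁}
    {Y Y' : Parabolic E₂} (h : dist Y Y' ≤ Λ * dist Ξ Ξ') :
    dist Y Y' ^ (α : ℝ) ≤ Λ ^ (α : ℝ) * dist Ξ Ξ' ^ (α : ℝ) := by
  rw [← Real.mul_rpow hΛ dist_nonneg]
  exact Real.rpow_le_rpow dist_nonneg h α.2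

include hθ hf hmaps in
/-- Sup bound `‖D (f ∘ Θ)‖ ≤ B₁ A₁`. [folklore] -/
theorem norm_spaceDeriv_scomp_le {A₁ B₁ : ℝ} (hA₁ : ∀ Ξ ∈ W₁, ‖spaceDeriv θ Ξ‖ ≤ A₁)
    (hB₁ : ∀ X ∈ W₂, ‖spaceDeriv f X‖ ≤ B₁) {Ξ : Parabolic E₁} (hΞ : Ξ ∈ W₁) :
    ‖spaceDeriv (fun Ξ' : Parabolic E₁ => f ⟨θ Ξ', Ξ'.t⟩) Ξ‖ ≤ B₁ * A₁ := by
  rw [spaceDeriv_scomp hθ hf hmaps hΞ]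
  have hB0 : 0 ≤ B₁ := (norm_nonneg _).trans (hB₁ _ (hmaps Ξ hΞ))
  exact (ContinuousLinearMap.opNorm_comp_le _ _).trans
    (mul_le_mul (hB₁ _ (hmaps Ξ hΞ)) (hA₁ Ξ hΞ) (norm_nonneg _) hB0)

include hθ hf hmaps in
/-- Sup bound `‖∂ₜ (f ∘ Θ)‖ ≤ B₁ Aₜ + Bₜ`. [folklore] -/
theorem norm_timeDeriv_scomp_le {Aₜ B₁ Bₜ : ℝ} (hAₜ : ∀ Ξ ∈ W₁, ‖timeDeriv θ Ξ‖ ≤ Aₜ)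
    (hB₁ : ∀ X ∈ W₂, ‖spaceDeriv f X‖ ≤ B₁) (hBₜ : ∀ X ∈ W₂, ‖timeDeriv f X‖ ≤ Bₜ)
    {Ξ : Parabolic E₁} (hΞ : Ξ ∈ W₁) :
    ‖timeDeriv (fun Ξ' : Parabolic E₁ => f ⟨θ Ξ', Ξ'.t⟩) Ξ‖ ≤ B₁ * Aₜ + Bₜ := by
  rw [timeDeriv_scomp hθ hf hmaps hΞ]
  have hB0 : 0 ≤ B₁ := (norm_nonneg _).trans (hB₁ _ (hmaps Ξ hΞ))
  refine (norm_add_le _ _).trans (add_le_add ?_ (hBₜ _ (hmaps Ξ hΞ)))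
  exact (ContinuousLinearMap.le_opNorm _ _).trans
    (mul_le_mul (hB₁ _ (hmaps Ξ hΞ)) (hAₜ Ξ hΞ) (norm_nonneg _) hB0)

include hθ hf hmaps hW₁ in
/-- Sup bound `‖D² (f ∘ Θ)‖ ≤ B₂ A₁² + B₁ A₂`. [folklore] -/
theorem norm_spaceDeriv_spaceDeriv_scomp_le {A₁ A₂ B₁ B₂ : ℝ}
    (hA₁ : ∀ Ξ ∈ W₁, ‖spaceDeriv θ Ξ‖ ≤ A₁)
    (hA₂ : ∀ Ξ ∈ W₁, ‖spaceDeriv (spaceDeriv θ) Ξ‖ ≤ A₂)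
    (hB₁ : ∀ X ∈ W₂, ‖spaceDeriv f X‖ ≤ B₁)
    (hB₂ : ∀ X ∈ W₂, ‖spaceDeriv (spaceDeriv f) X‖ ≤ B₂) {Ξ : Parabolic E₁} (hΞ : Ξ ∈ W₁) :
    ‖spaceDeriv (spaceDeriv fun Ξ' : Parabolic E₁ => f ⟨θ Ξ', Ξ'.t⟩) Ξ‖ ≤
      B₂ * A₁ ^ 2 + B₁ * A₂ := by
  have hA0 : 0 ≤ A₁ := (norm_nonneg _).trans (hA₁ Ξ hΞ)
  have hB10 : 0 ≤ B₁ := (norm_nonneg _).trans (hB₁ _ (hmaps Ξ hΞ))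
  have hB20 : 0 ≤ B₂ := (norm_nonneg _).trans (hB₂ _ (hmaps Ξ hΞ))
  have hA20 : 0 ≤ A₂ := (norm_nonneg _).trans (hA₂ Ξ hΞ)
  refine ContinuousLinearMap.opNorm_le_bound _ (by positivity) fun v => ?_
  refine ContinuousLinearMap.opNorm_le_bound _ (by positivity) fun w => ?_
  rw [spaceDeriv_spaceDeriv_scomp hθ hf hmaps hW₁ hΞ]
  have h1 : ‖spaceDeriv (spaceDeriv f) ⟨θ Ξ, Ξ.t⟩ (spaceDeriv θ Ξ v) (spaceDeriv θ Ξ w)‖ ≤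
      B₂ * A₁ ^ 2 * ‖v‖ * ‖w‖ := by
    calc ‖spaceDeriv (spaceDeriv f) ⟨θ Ξ, Ξ.t⟩ (spaceDeriv θ Ξ v) (spaceDeriv θ Ξ w)‖
        ≤ ‖spaceDeriv (spaceDeriv f) ⟨θ Ξ, Ξ.t⟩‖ * ‖spaceDeriv θ Ξ v‖ * ‖spaceDeriv θ Ξ w‖ :=
          ContinuousLinearMap.le_opNorm₂ _ _ _
      _ ≤ B₂ * (A₁ * ‖v‖) * (A₁ * ‖w‖) := by
          gcongr
          · exact hB₂ _ (hmaps Ξ hΞ)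
          · exact (ContinuousLinearMap.le_opNorm _ _).trans
              (mul_le_mul_of_nonneg_right (hA₁ Ξ hΞ) (norm_nonneg _))
          · exact (ContinuousLinearMap.le_opNorm _ _).trans
              (mul_le_mul_of_nonneg_right (hA₁ Ξ hΞ) (norm_nonneg _))
      _ = B₂ * A₁ ^ 2 * ‖v‖ * ‖w‖ := by ring
  have h2 : ‖spaceDeriv f ⟨θ Ξ, Ξ.t⟩ (spaceDeriv (spaceDeriv θ) Ξ v w)‖ ≤
      B₁ * A₂ * ‖v‖ * ‖w‖ := by
    calc ‖spaceDeriv f ⟨θ Ξ, Ξ.t⟩ (spaceDeriv (spaceDeriv θ) Ξ v w)‖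
        ≤ ‖spaceDeriv f ⟨θ Ξ, Ξ.t⟩‖ * ‖spaceDeriv (spaceDeriv θ) Ξ v w‖ :=
          ContinuousLinearMap.le_opNorm _ _
      _ ≤ B₁ * (A₂ * ‖v‖ * ‖w‖) := by
          gcongr
          · exact hB₁ _ (hmaps Ξ hΞ)
          · exact (ContinuousLinearMap.le_opNorm₂ _ _ _).trans (by gcongr; exact hA₂ Ξ hΞ)
      _ = B₁ * A₂ * ‖v‖ * ‖w‖ := by ring
  calc _ ≤ ‖spaceDeriv (spaceDeriv f) ⟨θ Ξ, Ξ.t⟩ (spaceDeriv θ Ξ v) (spaceDeriv θ Ξ w)‖ +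
        ‖spaceDeriv f ⟨θ Ξ, Ξ.t⟩ (spaceDeriv (spaceDeriv θ) Ξ v w)‖ := norm_add_le _ _
    _ ≤ B₂ * A₁ ^ 2 * ‖v‖ * ‖w‖ + B₁ * A₂ * ‖v‖ * ‖w‖ := add_le_add h1 h2
    _ = (B₂ * A₁ ^ 2 + B₁ * A₂) * ‖v‖ * ‖w‖ := by ring

omit [NormedSpace ℝ E₁] [NormedSpace ℝ E₂] [NormedSpace ℝ F] in
include hmaps in
/-- Hölder modulus of `f ∘ Θ`: `‖g Ξ - g Ξ'‖ ≤ K₀ Λ^α d^α`. [folklore] -/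
theorem norm_scomp_sub_le {α : ℝ≥0} {K₀ Λ : ℝ} (hK0 : 0 ≤ K₀) (hΛ : 0 ≤ Λ)
    (hLip : ∀ Ξ ∈ W₁, ∀ Ξ' ∈ W₁,
      dist (⟨θ Ξ, Ξ.t⟩ : Parabolic E₂) ⟨θ Ξ', Ξ'.t⟩ ≤ Λ * dist Ξ Ξ')
    (hK₀ : ∀ X ∈ W₂, ∀ X' ∈ W₂, ‖f X - f X'‖ ≤ K₀ * dist X X' ^ (α : ℝ))
    {Ξ Ξ' : Parabolic E₁} (hΞ : Ξ ∈ W₁) (hΞ' : Ξ' ∈ W₁) :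
    ‖f ⟨θ Ξ, Ξ.t⟩ - f ⟨θ Ξ', Ξ'.t⟩‖ ≤ K₀ * Λ ^ (α : ℝ) * dist Ξ Ξ' ^ (α : ℝ) := by
  calc ‖f ⟨θ Ξ, Ξ.t⟩ - f ⟨θ Ξ', Ξ'.t⟩‖
      ≤ K₀ * dist (⟨θ Ξ, Ξ.t⟩ : Parabolic E₂) ⟨θ Ξ', Ξ'.t⟩ ^ (α : ℝ) :=
        hK₀ _ (hmaps Ξ hΞ) _ (hmaps Ξ' hΞ')
    _ ≤ K₀ * (Λ ^ (α : ℝ) * dist Ξ Ξ' ^ (α : ℝ)) :=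
        mul_le_mul_of_nonneg_left (rpow_dist_scomp_le hΛ (hLip Ξ hΞ Ξ' hΞ')) hK0
    _ = K₀ * Λ ^ (α : ℝ) * dist Ξ Ξ' ^ (α : ℝ) := by ring

include hθ hf hmaps in
/-- Hölder modulus of `D (f ∘ Θ)`: constant `K₁ Λ^α A₁ + B₁ C₁`. [folklore] -/
theorem norm_spaceDeriv_scomp_sub_le {α : ℝ≥0} {A₁ B₁ C₁ K₁ Λ : ℝ}
    (hB0 : 0 ≤ B₁) (hK0 : 0 ≤ K₁) (hΛ : 0 ≤ Λ)
    (hLip : ∀ Ξ ∈ W₁, ∀ Ξ' ∈ W₁,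
      dist (⟨θ Ξ, Ξ.t⟩ : Parabolic E₂) ⟨θ Ξ', Ξ'.t⟩ ≤ Λ * dist Ξ Ξ')
    (hA₁ : ∀ Ξ ∈ W₁, ‖spaceDeriv θ Ξ‖ ≤ A₁)
    (hC₁ : ∀ Ξ ∈ W₁, ∀ Ξ' ∈ W₁, ‖spaceDeriv θ Ξ - spaceDeriv θ Ξ'‖ ≤ C₁ * dist Ξ Ξ' ^ (α : ℝ))
    (hB₁ : ∀ X ∈ W₂, ‖spaceDeriv f X‖ ≤ B₁)
    (hK₁ : ∀ X ∈ W₂, ∀ X' ∈ W₂, ‖spaceDeriv f X - spaceDeriv f X'‖ ≤ K₁ * dist X X' ^ (α : ℝ))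
    {Ξ Ξ' : Parabolic E₁} (hΞ : Ξ ∈ W₁) (hΞ' : Ξ' ∈ W₁) :
    ‖spaceDeriv (fun Ξ' : Parabolic E₁ => f ⟨θ Ξ', Ξ'.t⟩) Ξ -
        spaceDeriv (fun Ξ' : Parabolic E₁ => f ⟨θ Ξ', Ξ'.t⟩) Ξ'‖ ≤
      (K₁ * Λ ^ (α : ℝ) * A₁ + B₁ * C₁) * dist Ξ Ξ' ^ (α : ℝ) := by
  rw [spaceDeriv_scomp hθ hf hmaps hΞ, spaceDeriv_scomp hθ hf hmaps hΞ']
  have hd : 0 ≤ dist Ξ Ξ' ^ (α : ℝ) := by positivity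
  have h1 : ‖spaceDeriv f ⟨θ Ξ, Ξ.t⟩ - spaceDeriv f ⟨θ Ξ', Ξ'.t⟩‖ ≤
      K₁ * Λ ^ (α : ℝ) * dist Ξ Ξ' ^ (α : ℝ) :=
    calc _ ≤ K₁ * dist (⟨θ Ξ, Ξ.t⟩ : Parabolic E₂) ⟨θ Ξ', Ξ'.t⟩ ^ (α : ℝ) :=
          hK₁ _ (hmaps Ξ hΞ) _ (hmaps Ξ' hΞ')
      _ ≤ K₁ * (Λ ^ (α : ℝ) * dist Ξ Ξ' ^ (α : ℝ)) :=
          mul_le_mul_of_nonneg_left (rpow_dist_scomp_le hΛ (hLip Ξ hΞ Ξ' hΞ')) hK0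
      _ = _ := by ring
  calc _ ≤ ‖spaceDeriv f ⟨θ Ξ, Ξ.t⟩ - spaceDeriv f ⟨θ Ξ', Ξ'.t⟩‖ * ‖spaceDeriv θ Ξ‖ +
        ‖spaceDeriv f ⟨θ Ξ', Ξ'.t⟩‖ * ‖spaceDeriv θ Ξ - spaceDeriv θ Ξ'‖ :=
        norm_comp_sub_comp_le _ _ _ _
    _ ≤ K₁ * Λ ^ (α : ℝ) * dist Ξ Ξ' ^ (α : ℝ) * A₁ + B₁ * (C₁ * dist Ξ Ξ' ^ (α : ℝ)) :=
        add_le_add (mul_le_mul h1 (hA₁ Ξ hΞ) (norm_nonneg _) (by positivity))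
          (mul_le_mul (hB₁ _ (hmaps Ξ' hΞ')) (hC₁ Ξ hΞ Ξ' hΞ') (norm_nonneg _) hB0)
    _ = (K₁ * Λ ^ (α : ℝ) * A₁ + B₁ * C₁) * dist Ξ Ξ' ^ (α : ℝ) := by ring

include hθ hf hmaps in
/-- Hölder modulus of `∂ₜ (f ∘ Θ)`: constant `K₁ Λ^α Aₜ + B₁ Cₜ + Kₜ Λ^α`. [folklore] -/
theorem norm_timeDeriv_scomp_sub_le {α : ℝ≥0} {Aₜ B₁ Cₜ K₁ Kₜ Λ : ℝ}
    (hB0 : 0 ≤ B₁) (hK0 : 0 ≤ K₁) (hKt0 : 0 ≤ Kₜ) (hΛ : 0 ≤ Λ)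
    (hLip : ∀ Ξ ∈ W₁, ∀ Ξ' ∈ W₁,
      dist (⟨θ Ξ, Ξ.t⟩ : Parabolic E₂) ⟨θ Ξ', Ξ'.t⟩ ≤ Λ * dist Ξ Ξ')
    (hAₜ : ∀ Ξ ∈ W₁, ‖timeDeriv θ Ξ‖ ≤ Aₜ)
    (hCₜ : ∀ Ξ ∈ W₁, ∀ Ξ' ∈ W₁, ‖timeDeriv θ Ξ - timeDeriv θ Ξ'‖ ≤ Cₜ * dist Ξ Ξ' ^ (α : ℝ))
    (hB₁ : ∀ X ∈ W₂, ‖spaceDeriv f X‖ ≤ B₁)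
    (hK₁ : ∀ X ∈ W₂, ∀ X' ∈ W₂, ‖spaceDeriv f X - spaceDeriv f X'‖ ≤ K₁ * dist X X' ^ (α : ℝ))
    (hKₜ : ∀ X ∈ W₂, ∀ X' ∈ W₂, ‖timeDeriv f X - timeDeriv f X'‖ ≤ Kₜ * dist X X' ^ (α : ℝ))
    {Ξ Ξ' : Parabolic E₁} (hΞ : Ξ ∈ W₁) (hΞ' : Ξ' ∈ W₁) :
    ‖timeDeriv (fun Ξ' : Parabolic E₁ => f ⟨θ Ξ', Ξ'.t⟩) Ξ -
        timeDeriv (fun Ξ' : Parabolic E₁ => f ⟨θ Ξ', Ξ'.t⟩) Ξ'‖ ≤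
      (K₁ * Λ ^ (α : ℝ) * Aₜ + B₁ * Cₜ + Kₜ * Λ ^ (α : ℝ)) * dist Ξ Ξ' ^ (α : ℝ) := by
  rw [timeDeriv_scomp hθ hf hmaps hΞ, timeDeriv_scomp hθ hf hmaps hΞ']
  have hd : 0 ≤ dist Ξ Ξ' ^ (α : ℝ) := by positivity
  have hdist := rpow_dist_scomp_le (α := α) hΛ (hLip Ξ hΞ Ξ' hΞ')
  have h1 : ‖spaceDeriv f ⟨θ Ξ, Ξ.t⟩ - spaceDeriv f ⟨θ Ξ', Ξ'.t⟩‖ ≤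
      K₁ * Λ ^ (α : ℝ) * dist Ξ Ξ' ^ (α : ℝ) :=
    calc _ ≤ K₁ * dist (⟨θ Ξ, Ξ.t⟩ : Parabolic E₂) ⟨θ Ξ', Ξ'.t⟩ ^ (α : ℝ) :=
          hK₁ _ (hmaps Ξ hΞ) _ (hmaps Ξ' hΞ')
      _ ≤ K₁ * (Λ ^ (α : ℝ) * dist Ξ Ξ' ^ (α : ℝ)) := mul_le_mul_of_nonneg_left hdist hK0
      _ = _ := by ring
  have h2 : ‖timeDeriv f ⟨θ Ξ, Ξ.t⟩ - timeDeriv f ⟨θ Ξ', Ξ'.t⟩‖ ≤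
      Kₜ * Λ ^ (α : ℝ) * dist Ξ Ξ' ^ (α : ℝ) :=
    calc _ ≤ Kₜ * dist (⟨θ Ξ, Ξ.t⟩ : Parabolic E₂) ⟨θ Ξ', Ξ'.t⟩ ^ (α : ℝ) :=
          hKₜ _ (hmaps Ξ hΞ) _ (hmaps Ξ' hΞ')
      _ ≤ Kₜ * (Λ ^ (α : ℝ) * dist Ξ Ξ' ^ (α : ℝ)) := mul_le_mul_of_nonneg_left hdist hKt0
      _ = _ := by ring
  have hsplit : spaceDeriv f ⟨θ Ξ, Ξ.t⟩ (timeDeriv θ Ξ) + timeDeriv f ⟨θ Ξ, Ξ.t⟩ -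
      (spaceDeriv f ⟨θ Ξ', Ξ'.t⟩ (timeDeriv θ Ξ') + timeDeriv f ⟨θ Ξ', Ξ'.t⟩) =
      (spaceDeriv f ⟨θ Ξ, Ξ.t⟩ (timeDeriv θ Ξ) - spaceDeriv f ⟨θ Ξ', Ξ'.t⟩ (timeDeriv θ Ξ')) +
        (timeDeriv f ⟨θ Ξ, Ξ.t⟩ - timeDeriv f ⟨θ Ξ', Ξ'.t⟩) := by abel
  rw [hsplit]
  calc _ ≤ ‖spaceDeriv f ⟨θ Ξ, Ξ.t⟩ (timeDeriv θ Ξ) - spaceDeriv f ⟨θ Ξ', Ξ'.t⟩ (timeDeriv θ Ξ')‖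
        + ‖timeDeriv f ⟨θ Ξ, Ξ.t⟩ - timeDeriv f ⟨θ Ξ', Ξ'.t⟩‖ := norm_add_le _ _
    _ ≤ (‖spaceDeriv f ⟨θ Ξ, Ξ.t⟩ - spaceDeriv f ⟨θ Ξ', Ξ'.t⟩‖ * ‖timeDeriv θ Ξ‖ +
          ‖spaceDeriv f ⟨θ Ξ', Ξ'.t⟩‖ * ‖timeDeriv θ Ξ - timeDeriv θ Ξ'‖) +
        Kₜ * Λ ^ (α : ℝ) * dist Ξ Ξ' ^ (α : ℝ) :=
        add_le_add (norm_apply_sub_apply_le _ _ _ _) h2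
    _ ≤ (K₁ * Λ ^ (α : ℝ) * dist Ξ Ξ' ^ (α : ℝ) * Aₜ + B₁ * (Cₜ * dist Ξ Ξ' ^ (α : ℝ))) +
        Kₜ * Λ ^ (α : ℝ) * dist Ξ Ξ' ^ (α : ℝ) :=
        add_le_add (add_le_add (mul_le_mul h1 (hAₜ Ξ hΞ) (norm_nonneg _) (by positivity))
          (mul_le_mul (hB₁ _ (hmaps Ξ' hΞ')) (hCₜ Ξ hΞ Ξ' hΞ') (norm_nonneg _) hB0)) le_rfl
    _ = (K₁ * Λ ^ (α : ℝ) * Aₜ + B₁ * Cₜ + Kₜ * Λ ^ (α : ℝ)) * dist Ξ Ξ' ^ (α : ℝ) := by ring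

include hθ hf hmaps hW₁ in
/-- Hölder modulus of `D² (f ∘ Θ)`: constant
`K₂ Λ^α A₁² + 2 B₂ A₁ C₁ + K₁ Λ^α A₂ + B₁ C₂`. [folklore] -/
theorem norm_spaceDeriv_spaceDeriv_scomp_sub_le {α : ℝ≥0} {A₁ A₂ B₁ B₂ C₁ C₂ K₁ K₂ Λ : ℝ}
    (hA0 : 0 ≤ A₁) (hA20 : 0 ≤ A₂) (hB0 : 0 ≤ B₁) (hB20 : 0 ≤ B₂) (hC10 : 0 ≤ C₁)
    (hC20 : 0 ≤ C₂) (hK0 : 0 ≤ K₁) (hK20 : 0 ≤ K₂) (hΛ : 0 ≤ Λ)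
    (hLip : ∀ Ξ ∈ W₁, ∀ Ξ' ∈ W₁,
      dist (⟨θ Ξ, Ξ.t⟩ : Parabolic E₂) ⟨θ Ξ', Ξ'.t⟩ ≤ Λ * dist Ξ Ξ')
    (hA₁ : ∀ Ξ ∈ W₁, ‖spaceDeriv θ Ξ‖ ≤ A₁)
    (hA₂ : ∀ Ξ ∈ W₁, ‖spaceDeriv (spaceDeriv θ) Ξ‖ ≤ A₂)
    (hC₁ : ∀ Ξ ∈ W₁, ∀ Ξ' ∈ W₁, ‖spaceDeriv θ Ξ - spaceDeriv θ Ξ'‖ ≤ C₁ * dist Ξ Ξ' ^ (α : ℝ))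
    (hC₂ : ∀ Ξ ∈ W₁, ∀ Ξ' ∈ W₁, ‖spaceDeriv (spaceDeriv θ) Ξ - spaceDeriv (spaceDeriv θ) Ξ'‖ ≤
      C₂ * dist Ξ Ξ' ^ (α : ℝ))
    (hB₁ : ∀ X ∈ W₂, ‖spaceDeriv f X‖ ≤ B₁)
    (hB₂ : ∀ X ∈ W₂, ‖spaceDeriv (spaceDeriv f) X‖ ≤ B₂)
    (hK₁ : ∀ X ∈ W₂, ∀ X' ∈ W₂, ‖spaceDeriv f X - spaceDeriv f X'‖ ≤ K₁ * dist X X' ^ (α : ℝ))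
    (hK₂ : ∀ X ∈ W₂, ∀ X' ∈ W₂, ‖spaceDeriv (spaceDeriv f) X - spaceDeriv (spaceDeriv f) X'‖ ≤
      K₂ * dist X X' ^ (α : ℝ))
    {Ξ Ξ' : Parabolic E₁} (hΞ : Ξ ∈ W₁) (hΞ' : Ξ' ∈ W₁) :
    ‖spaceDeriv (spaceDeriv fun Ξ' : Parabolic E₁ => f ⟨θ Ξ', Ξ'.t⟩) Ξ -
        spaceDeriv (spaceDeriv fun Ξ' : Parabolic E₁ => f ⟨θ Ξ', Ξ'.t⟩) Ξ'‖ ≤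
      (K₂ * Λ ^ (α : ℝ) * A₁ ^ 2 + 2 * B₂ * A₁ * C₁ + K₁ * Λ ^ (α : ℝ) * A₂ + B₁ * C₂) *
        dist Ξ Ξ' ^ (α : ℝ) := by
  have hd : 0 ≤ dist Ξ Ξ' ^ (α : ℝ) := by positivity
  have hdist := rpow_dist_scomp_le (α := α) hΛ (hLip Ξ hΞ Ξ' hΞ')
  set dα := dist Ξ Ξ' ^ (α : ℝ) with hdα
  -- the pieces at the two points
  set M := spaceDeriv (spaceDeriv f) ⟨θ Ξ, Ξ.t⟩ with hM
  set M' := spaceDeriv (spaceDeriv f) ⟨θ Ξ', Ξ'.t⟩ with hM'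
  set R := spaceDeriv θ Ξ with hR
  set R' := spaceDeriv θ Ξ' with hR'
  set S := spaceDeriv f ⟨θ Ξ, Ξ.t⟩ with hS
  set S' := spaceDeriv f ⟨θ Ξ', Ξ'.t⟩ with hS'
  set Q := spaceDeriv (spaceDeriv θ) Ξ with hQ
  set Q' := spaceDeriv (spaceDeriv θ) Ξ' with hQ'
  have hMM' : ‖M - M'‖ ≤ K₂ * Λ ^ (α : ℝ) * dα :=
    calc _ ≤ K₂ * dist (⟨θ Ξ, Ξ.t⟩ : Parabolic E₂) ⟨θ Ξ', Ξ'.t⟩ ^ (α : ℝ) :=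
          hK₂ _ (hmaps Ξ hΞ) _ (hmaps Ξ' hΞ')
      _ ≤ K₂ * (Λ ^ (α : ℝ) * dα) := mul_le_mul_of_nonneg_left hdist hK20
      _ = _ := by ring
  have hSS' : ‖S - S'‖ ≤ K₁ * Λ ^ (α : ℝ) * dα :=
    calc _ ≤ K₁ * dist (⟨θ Ξ, Ξ.t⟩ : Parabolic E₂) ⟨θ Ξ', Ξ'.t⟩ ^ (α : ℝ) :=
          hK₁ _ (hmaps Ξ hΞ) _ (hmaps Ξ' hΞ')
      _ ≤ K₁ * (Λ ^ (α : ℝ) * dα) := mul_le_mul_of_nonneg_left hdist hK0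
      _ = _ := by ring
  have hRR' : ‖R - R'‖ ≤ C₁ * dα := hC₁ Ξ hΞ Ξ' hΞ'
  have hQQ' : ‖Q - Q'‖ ≤ C₂ * dα := hC₂ Ξ hΞ Ξ' hΞ'
  have hRb : ‖R‖ ≤ A₁ := hA₁ Ξ hΞ
  have hR'b : ‖R'‖ ≤ A₁ := hA₁ Ξ' hΞ'
  have hM'b : ‖M'‖ ≤ B₂ := hB₂ _ (hmaps Ξ' hΞ')
  have hS'b : ‖S'‖ ≤ B₁ := hB₁ _ (hmaps Ξ' hΞ')
  have hQb : ‖Q‖ ≤ A₂ := hA₂ Ξ hΞ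
  have hpos : 0 ≤ K₂ * Λ ^ (α : ℝ) * A₁ ^ 2 + 2 * B₂ * A₁ * C₁ + K₁ * Λ ^ (α : ℝ) * A₂ +
      B₁ * C₂ := by positivity
  refine ContinuousLinearMap.opNorm_le_bound _ (mul_nonneg hpos hd) fun v => ?_
  refine ContinuousLinearMap.opNorm_le_bound _ (by positivity) fun w => ?_
  rw [sub_apply, sub_apply,
    spaceDeriv_spaceDeriv_scomp hθ hf hmaps hW₁ hΞ, spaceDeriv_spaceDeriv_scomp hθ hf hmaps hW₁ hΞ']
  have hsplit : M (R v) (R w) + S (Q v w) - (M' (R' v) (R' w) + S' (Q' v w)) =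
      (M (R v) (R w) - M' (R' v) (R' w)) + (S (Q v w) - S' (Q' v w)) := by abel
  rw [hsplit]
  have h1 : ‖M (R v) (R w) - M' (R' v) (R' w)‖ ≤
      (K₂ * Λ ^ (α : ℝ) * A₁ ^ 2 + 2 * B₂ * A₁ * C₁) * dα * ‖v‖ * ‖w‖ := by
    refine (norm_bilin_comp_sub_le M M' R R' v w).trans ?_
    have hvw : 0 ≤ ‖v‖ * ‖w‖ := by positivity
    have hin : ‖M - M'‖ * ‖R‖ ^ 2 + ‖M'‖ * ‖R - R'‖ * (‖R‖ + ‖R'‖) ≤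
        (K₂ * Λ ^ (α : ℝ) * A₁ ^ 2 + 2 * B₂ * A₁ * C₁) * dα := by
      have e1 : ‖M - M'‖ * ‖R‖ ^ 2 ≤ K₂ * Λ ^ (α : ℝ) * dα * A₁ ^ 2 :=
        mul_le_mul hMM' (pow_le_pow_left₀ (norm_nonneg _) hRb 2) (by positivity)
          (by positivity)
      have e2 : ‖M'‖ * ‖R - R'‖ * (‖R‖ + ‖R'‖) ≤ B₂ * (C₁ * dα) * (A₁ + A₁) :=
        mul_le_mul (mul_le_mul hM'b hRR' (norm_nonneg _) hB20) (add_le_add hRb hR'b)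
          (by positivity) (by positivity)
      calc _ ≤ K₂ * Λ ^ (α : ℝ) * dα * A₁ ^ 2 + B₂ * (C₁ * dα) * (A₁ + A₁) := add_le_add e1 e2
        _ = _ := by ring
    calc (‖M - M'‖ * ‖R‖ ^ 2 + ‖M'‖ * ‖R - R'‖ * (‖R‖ + ‖R'‖)) * ‖v‖ * ‖w‖
        = (‖M - M'‖ * ‖R‖ ^ 2 + ‖M'‖ * ‖R - R'‖ * (‖R‖ + ‖R'‖)) * (‖v‖ * ‖w‖) := by ring
      _ ≤ (K₂ * Λ ^ (α : ℝ) * A₁ ^ 2 + 2 * B₂ * A₁ * C₁) * dα * (‖v‖ * ‖w‖) :=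
          mul_le_mul_of_nonneg_right hin hvw
      _ = _ := by ring
  have h2 : ‖S (Q v w) - S' (Q' v w)‖ ≤ (K₁ * Λ ^ (α : ℝ) * A₂ + B₁ * C₂) * dα * ‖v‖ * ‖w‖ := by
    refine (norm_apply_sub_apply_le S S' (Q v w) (Q' v w)).trans ?_
    have e1 : ‖Q v w‖ ≤ A₂ * ‖v‖ * ‖w‖ :=
      (ContinuousLinearMap.le_opNorm₂ _ _ _).trans (by gcongr)
    have e2 : ‖Q v w - Q' v w‖ ≤ C₂ * dα * ‖v‖ * ‖w‖ := by
      rw [← sub_apply, ← sub_apply]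
      exact (ContinuousLinearMap.le_opNorm₂ _ _ _).trans (by gcongr)
    have e3 : ‖S - S'‖ * ‖Q v w‖ ≤ K₁ * Λ ^ (α : ℝ) * dα * (A₂ * ‖v‖ * ‖w‖) :=
      mul_le_mul hSS' e1 (norm_nonneg _) (by positivity)
    have e4 : ‖S'‖ * ‖Q v w - Q' v w‖ ≤ B₁ * (C₂ * dα * ‖v‖ * ‖w‖) :=
      mul_le_mul hS'b e2 (norm_nonneg _) hB0
    calc _ ≤ K₁ * Λ ^ (α : ℝ) * dα * (A₂ * ‖v‖ * ‖w‖) + B₁ * (C₂ * dα * ‖v‖ * ‖w‖) :=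
          add_le_add e3 e4
      _ = _ := by ring
  calc ‖M (R v) (R w) - M' (R' v) (R' w) + (S (Q v w) - S' (Q' v w))‖
      ≤ ‖M (R v) (R w) - M' (R' v) (R' w)‖ + ‖S (Q v w) - S' (Q' v w)‖ := norm_add_le _ _
    _ ≤ (K₂ * Λ ^ (α : ℝ) * A₁ ^ 2 + 2 * B₂ * A₁ * C₁) * dα * ‖v‖ * ‖w‖ +
        (K₁ * Λ ^ (α : ℝ) * A₂ + B₁ * C₂) * dα * ‖v‖ * ‖w‖ := add_le_add h1 h2
    _ = (K₂ * Λ ^ (α : ℝ) * A₁ ^ 2 + 2 * B₂ * A₁ * C₁ + K₁ * Λ ^ (α : ℝ) * A₂ + B₁ * C₂) * dα *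
        ‖v‖ * ‖w‖ := by ring

end Bounds


end Parabolic

end Literature.Analysis.PDE
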